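import Summits.CriticalPhenomena.PercolationContinuityZ3.Theorems.FK.InfiniteVolumeDLRKernelInsert
import Summits.CriticalPhenomena.PercolationContinuityZ3.Theorems.FK.InfiniteVolumeDLRMeasures
import Literature.Probability.Percolation.DeletionTolerance
import HarnessLib

/-!
# FK-continuity transplant, FO-06/FO-10 (infinite-volume structure): from the one-edge conditional
# probabilities (4.38) to the DLR equation on every finite region — Grimmett 2006, Prop. (4.37)(b), the engine

Registered R72 (cell INBOX l.5361, 2026-08-23); registry row FO-10b-g407; label DLR1e-B (coordinator fk-4 g140).
Cell `fk-continuity` (bschramm), FO-10b lineage (conditional one-edge energies); support file for the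
FK-continuity transplant (`--supports stmt-CriticalPhenomena-4575`); builds on p205010 (kernel theorem,
internal audit signed; external expert review pending). No named facts, no definitions, no sorries, standard
axioms. General dimension `d`, `0 ≤ p ≤ 1`, `q > 0`, ANY finite measure `P` on `Ω = {0,1}^{E(ℤ^d)}`. Banked
infinite-volume structure (the half of GRC Prop. (4.37) recorded as "not formalised here" in
`InfiniteVolumeOneEdgeDLRClosed.lean`); not an END-STATE dependency of the cell (not consumed by `_r3`); it says
nothing about FH / TP_FK or continuity at `p_c`.

**The hypothesis** (Grimmett's (4.38), in the integrated form of `IsBoxLimit.real_edgeOpen_inter_preimage_eq`):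
for every lattice edge `e = ⟨x,y⟩` and every measurable `H₀`,
`P({e open} ∩ {ω ∖ e ∈ H₀}) = p · P({ω ∖ e ∈ H₀ ∩ K}) + p/(p + q(1-p)) · P({ω ∖ e ∈ H₀ ∖ K})`, `K = {x ↔ y}` —
i.e. `P(J_e | 𝒯_e) = p` on `K_e` and `= p/(p + q(1-p))` off `K_e` (the events `{ω ∖ e ∈ H₀}` are exactly the
`𝒯_e`-measurable ones).

**The conclusion of this file** (`real_cylEvent_inter_eq_rcCondProb_mul_of_fibre`, Grimmett's "`μ^ξ = φ^ξ_{Λ,p,q}`"):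
for a finite region `Λ` and an outside event `H ∈ 𝒯_Λ` lying inside ONE FIBRE — an event on which every connection
question "`u ↔ v` in `η' ∪ (ω ∖ E_Λ)`?" (`η' ⊆ E_Λ`, `u, v ∈ Λ`) has the same answer as at a fixed configuration
`ξ₀` — and every inside pattern `η ⊆ E_Λ`: `P({ω ∩ E_Λ = η} ∩ H) = φ^{ξ₀}_{Λ,p,q}(η) · P(H)`.
`InfiniteVolumeDLROneEdgeIff.lean` sums this over the finitely many fibres of `𝒯_Λ` (on each of which the kernel is
constant, `rcCondProb_congr_of_forall_reachable_iff`) to get the DLR equation (4.30) on cylinders,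
`P({ω ∩ E_Λ = η} ∩ H) = ∫_H φ^ξ_{Λ,p,q}(η) P(dξ)` for every `H ∈ 𝒯_Λ`, and assembles `P ∈ R_{p,q}` (Def. (4.29)).

**Proof** (Grimmett's two lines "by (4.38) and Theorem 3.1(b)", carried out without conditional measures). For
`H` inside one fibre, the numbers `m(η) = P({ω ∩ E_Λ = η} ∩ H)` and `c(η) = φ^{ξ₀}_Λ(η)` satisfy the SAME one-edge
relations `m(η ∪ e)(1 - π) = π m(η)`, `c(η ∪ e)(1 - π) = π c(η)` (`π ∈ {p, p/(p+q(1-p))}` decided by the fibre):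
the first by (4.38) applied to the `𝒯_e`-event `{ω ∩ (E_Λ ∖ e) = η} ∩ H`, on which `ω ∖ e = η ∪ (ω ∖ E_Λ)`
(`real_cylEvent_insert_inter_eq_of_oneEdge`, `…_mul_of_reachable`, `…_mul_of_not_reachable`), the second by the
kernel's one-edge ratio (`rcCondProb_insert_mul_one_sub`, `InfiniteVolumeDLRKernelInsert.lean`). Two functions on
the hypercube `2^{E_Λ}` with the same edge ratios and total masses `P(H)` and `1` agree up to the factor `P(H)`
(`mul_eq_mul_of_forall_insert`, for `p < 1`; at `p = 1` both vanish off the full pattern).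

## References

* G. Grimmett, *The Random-Cluster Model*, Springer 2006: Thm. (3.1)(b) eq. (3.3), Def. (4.29) eq. (4.30),
  Prop. (4.37)(b) eq. (4.38) and its proof, pp. 81–87. [Grimmett2006]
* H.-O. Georgii, *Gibbs Measures and Phase Transitions*, 2nd ed. 2011, Thm. (1.33) (a specification is
  determined by its one-site kernels). [Georgii2011]
-/

noncomputable section

open MeasureTheory Set Filter
open scoped Topology ENNReal

namespace Summit.CriticalPhenomena.PercolationContinuityZ3.Theorems.FK

open Literature.Probability.Percolation Literature.Probability.LatticeModels

variable {d : ℕ}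

/-! ### One step: the one-edge relation for the cylinder probabilities inside an outside event -/

section Step

variable {p q : ℝ} {P : Measure (BondConfig (Site d))}

/-- **The one-edge relation for cylinder probabilities** (the first of Grimmett's two ingredients for
Prop. (4.37)(b)): under (4.38), for a finite region `Λ`, an inside edge `e = ⟨x,y⟩ ∈ E_Λ`, an inside pattern
`η ⊆ E_Λ` with `e ∉ η`, and an outside event `H ∈ 𝒯_Λ`,
`P({ω ∩ E_Λ = η ∪ e} ∩ H) = p · P(C' ∩ H ∩ K^η) + p/(p+q(1-p)) · P(C' ∩ H ∖ K^η)` with `C' = {ω ∩ (E_Λ ∖ e) = η}`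
and `K^η = {x ↔ y in η ∪ (ω ∖ E_Λ)}` — (4.38) applied to the `𝒯_e`-event `C' ∩ H`, on which `ω ∖ e = η ∪ (ω ∖ E_Λ)`.
[cite: Grimmett2006, Prop. (4.37)(b) eq. (4.38), proof p. 87] -/
theorem real_cylEvent_insert_inter_eq_of_oneEdge
    (hE : ∀ ⦃x y : Site d⦄, (zdGraph d).Adj x y → ∀ ⦃H₀ : Set (BondConfig (Site d))⦄, MeasurableSet H₀ →
      P.real ({ω | s(x, y) ∈ ω} ∩ (fun η => η \ {s(x, y)}) ⁻¹' H₀) =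
        p * P.real ((fun η => η \ {s(x, y)}) ⁻¹' (H₀ ∩ openConn x y)) +
          p / (p + q * (1 - p)) * P.real ((fun η => η \ {s(x, y)}) ⁻¹' (H₀ ∩ (openConn x y)ᶜ)))
    (Λ : Finset (Site d)) {x y : Site d} (he : s(x, y) ∈ edgesIn (zdGraph d) Λ) {η : Finset (Sym2 (Site d))}
    (hη : η ⊆ edgesIn (zdGraph d) Λ) (heη : s(x, y) ∉ η) {H : Set (BondConfig (Site d))}
    (hH : MeasurableSet[outsideEvents d Λ] H) :
    P.real (cylEvent (edgesIn (zdGraph d) Λ) (insert s(x, y) η) ∩ H) =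
      p * P.real (cylEvent ((edgesIn (zdGraph d) Λ).erase s(x, y)) η ∩ H ∩
          {ω | (openGraph ((↑η : Set (Sym2 (Site d))) ∪ (ω \ ↑(edgesIn (zdGraph d) Λ)))).Reachable x y}) +
        p / (p + q * (1 - p)) * P.real ((cylEvent ((edgesIn (zdGraph d) Λ).erase s(x, y)) η ∩ H) \
          {ω | (openGraph ((↑η : Set (Sym2 (Site d))) ∪ (ω \ ↑(edgesIn (zdGraph d) Λ)))).Reachable x y}) := by
  classical
  set U := edgesIn (zdGraph d) Λ with hU
  set f : BondConfig (Site d) → BondConfig (Site d) := fun ω => ω \ {s(x, y)} with hf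
  set C' := cylEvent (U.erase s(x, y)) η with hC'
  set Kη : Set (BondConfig (Site d)) :=
    {ω | (openGraph ((↑η : Set (Sym2 (Site d))) ∪ (ω \ ↑U))).Reachable x y} with hKη
  have hxy : (zdGraph d).Adj x y := (SimpleGraph.mem_edgeSet _).1 (mem_edgesIn_iff.1 he).1
  have hHm : MeasurableSet H := outsideEvents_le Λ _ hH
  have hC'm : MeasurableSet C' := measurableSet_cylEvent _ _
  -- the `𝒯_e`-event `C' ∩ H` is invariant under the removal of `e`
  have hinv : f ⁻¹' (C' ∩ H) = C' ∩ H := by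
    ext ω
    change ω \ {s(x, y)} ∈ C' ∩ H ↔ ω ∈ C' ∩ H
    refine and_congr ?_ (sdiff_singleton_mem_iff_of_outsideEvents hH he ω)
    simp only [hC', mem_cylEvent_iff, Finset.mem_erase, Set.mem_sdiff, Set.mem_singleton_iff]
    exact forall₂_congr fun i hi => by rw [and_iff_left hi.1]
  -- on `C'`, `ω ∖ e = η ∪ (ω ∖ E_Λ)`, so `K_e` is read as the outside event `K^η`
  have hKpt : ∀ ω ∈ C', (ω ∈ f ⁻¹' openConn x y ↔ ω ∈ Kη) := fun ω hC => by
    change (openGraph (ω \ {s(x, y)})).Reachable x y ↔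
      (openGraph ((↑η : Set (Sym2 (Site d))) ∪ (ω \ ↑U))).Reachable x y
    rw [sdiff_singleton_eq_union_sdiff_of_mem_cylEvent he hη heη hC]
  have h1 : f ⁻¹' ((C' ∩ H) ∩ openConn x y) = C' ∩ H ∩ Kη := by
    rw [Set.preimage_inter, hinv]
    ext ω
    exact ⟨fun ⟨hCH, hK⟩ => ⟨hCH, (hKpt ω hCH.1).1 hK⟩, fun ⟨hCH, hK⟩ => ⟨hCH, (hKpt ω hCH.1).2 hK⟩⟩
  have h2 : f ⁻¹' ((C' ∩ H) ∩ (openConn x y)ᶜ) = (C' ∩ H) \ Kη := by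
    rw [Set.preimage_inter, hinv, Set.preimage_compl]
    ext ω
    exact ⟨fun ⟨hCH, hK⟩ => ⟨hCH, fun hK' => hK ((hKpt ω hCH.1).2 hK')⟩,
      fun ⟨hCH, hK⟩ => ⟨hCH, fun hK' => hK ((hKpt ω hCH.1).1 hK')⟩⟩
  have h0 : {ω : BondConfig (Site d) | s(x, y) ∈ ω} ∩ f ⁻¹' (C' ∩ H) = cylEvent U (insert s(x, y) η) ∩ H := by
    rw [hinv, ← Set.inter_assoc, setOf_mem_inter_cylEvent_erase he]
  have h := hE hxy (hC'm.inter hHm)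
  rw [h0, h1, h2] at h
  exact h

/-- The cylinder over `E_Λ ∖ e` splits along the state of `e`:
`P({ω ∩ (E_Λ ∖ e) = η} ∩ A) = P({ω ∩ E_Λ = η} ∩ A) + P({ω ∩ E_Λ = η ∪ e} ∩ A)`. [folklore] -/
theorem real_cylEvent_erase_inter_eq_add (P : Measure (BondConfig (Site d))) [IsFiniteMeasure P]
    {U η : Finset (Sym2 (Site d))} {e : Sym2 (Site d)} (he : e ∈ U) (heη : e ∉ η)
    {A : Set (BondConfig (Site d))} (hA : MeasurableSet A) :
    P.real (cylEvent (U.erase e) η ∩ A) = P.real (cylEvent U η ∩ A) + P.real (cylEvent U (insert e η) ∩ A) := by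
  classical
  rw [cylEvent_erase_eq_union heη, Set.union_inter_distrib_right]
  exact measureReal_union ((disjoint_cylEvent_insert he heη).mono Set.inter_subset_left Set.inter_subset_left)
    ((measurableSet_cylEvent U _).inter hA)

/-- **The one-edge relation, decided case `x ↔ y`**: if `H ∈ 𝒯_Λ` lies inside `K^η = {x ↔ y in η ∪ (ω ∖ E_Λ)}`,
then `P({ω ∩ E_Λ = η ∪ e} ∩ H) · (1 - p) = p · P({ω ∩ E_Λ = η} ∩ H)`. [cite: Grimmett2006, Prop. (4.37)(b) eq. (4.38), Thm. (3.1) eq. (3.3)] -/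
theorem real_cylEvent_insert_inter_mul_of_reachable [IsFiniteMeasure P]
    (hE : ∀ ⦃x y : Site d⦄, (zdGraph d).Adj x y → ∀ ⦃H₀ : Set (BondConfig (Site d))⦄, MeasurableSet H₀ →
      P.real ({ω | s(x, y) ∈ ω} ∩ (fun η => η \ {s(x, y)}) ⁻¹' H₀) =
        p * P.real ((fun η => η \ {s(x, y)}) ⁻¹' (H₀ ∩ openConn x y)) +
          p / (p + q * (1 - p)) * P.real ((fun η => η \ {s(x, y)}) ⁻¹' (H₀ ∩ (openConn x y)ᶜ)))
    (Λ : Finset (Site d)) {x y : Site d} (he : s(x, y) ∈ edgesIn (zdGraph d) Λ) {η : Finset (Sym2 (Site d))}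
    (hη : η ⊆ edgesIn (zdGraph d) Λ) (heη : s(x, y) ∉ η) {H : Set (BondConfig (Site d))}
    (hH : MeasurableSet[outsideEvents d Λ] H)
    (hdec : ∀ ω ∈ H, (openGraph ((↑η : Set (Sym2 (Site d))) ∪ (ω \ ↑(edgesIn (zdGraph d) Λ)))).Reachable x y) :
    P.real (cylEvent (edgesIn (zdGraph d) Λ) (insert s(x, y) η) ∩ H) * (1 - p) =
      p * P.real (cylEvent (edgesIn (zdGraph d) Λ) η ∩ H) := by
  have hHm : MeasurableSet H := outsideEvents_le Λ _ hH
  have h := real_cylEvent_insert_inter_eq_of_oneEdge hE Λ he hη heη hH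
  have hin : cylEvent ((edgesIn (zdGraph d) Λ).erase s(x, y)) η ∩ H ∩
      {ω | (openGraph ((↑η : Set (Sym2 (Site d))) ∪ (ω \ ↑(edgesIn (zdGraph d) Λ)))).Reachable x y} =
      cylEvent ((edgesIn (zdGraph d) Λ).erase s(x, y)) η ∩ H :=
    Set.inter_eq_left.2 fun ω hω => hdec ω hω.2
  have hout : (cylEvent ((edgesIn (zdGraph d) Λ).erase s(x, y)) η ∩ H) \
      {ω | (openGraph ((↑η : Set (Sym2 (Site d))) ∪ (ω \ ↑(edgesIn (zdGraph d) Λ)))).Reachable x y} = ∅ :=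
    Set.sdiff_eq_empty.2 fun ω hω => hdec ω hω.2
  rw [hin, hout, measureReal_empty, mul_zero, add_zero, real_cylEvent_erase_inter_eq_add P he heη hHm] at h
  linear_combination h

/-- **The one-edge relation, decided case `x ↮ y`**: if `H ∈ 𝒯_Λ` is disjoint from `K^η`, then
`P({ω ∩ E_Λ = η ∪ e} ∩ H) · (1 - p') = p' · P({ω ∩ E_Λ = η} ∩ H)`, `p' = p/(p + q(1-p))`. [cite: Grimmett2006, Prop. (4.37)(b) eq. (4.38), Thm. (3.1) eq. (3.3)] -/
theorem real_cylEvent_insert_inter_mul_of_not_reachable [IsFiniteMeasure P]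
    (hE : ∀ ⦃x y : Site d⦄, (zdGraph d).Adj x y → ∀ ⦃H₀ : Set (BondConfig (Site d))⦄, MeasurableSet H₀ →
      P.real ({ω | s(x, y) ∈ ω} ∩ (fun η => η \ {s(x, y)}) ⁻¹' H₀) =
        p * P.real ((fun η => η \ {s(x, y)}) ⁻¹' (H₀ ∩ openConn x y)) +
          p / (p + q * (1 - p)) * P.real ((fun η => η \ {s(x, y)}) ⁻¹' (H₀ ∩ (openConn x y)ᶜ)))
    (Λ : Finset (Site d)) {x y : Site d} (he : s(x, y) ∈ edgesIn (zdGraph d) Λ) {η : Finset (Sym2 (Site d))}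
    (hη : η ⊆ edgesIn (zdGraph d) Λ) (heη : s(x, y) ∉ η) {H : Set (BondConfig (Site d))}
    (hH : MeasurableSet[outsideEvents d Λ] H)
    (hdec : ∀ ω ∈ H, ¬(openGraph ((↑η : Set (Sym2 (Site d))) ∪ (ω \ ↑(edgesIn (zdGraph d) Λ)))).Reachable x y) :
    P.real (cylEvent (edgesIn (zdGraph d) Λ) (insert s(x, y) η) ∩ H) * (1 - p / (p + q * (1 - p))) =
      p / (p + q * (1 - p)) * P.real (cylEvent (edgesIn (zdGraph d) Λ) η ∩ H) := by
  have hHm : MeasurableSet H := outsideEvents_le Λ _ hH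
  have h := real_cylEvent_insert_inter_eq_of_oneEdge hE Λ he hη heη hH
  have hin : cylEvent ((edgesIn (zdGraph d) Λ).erase s(x, y)) η ∩ H ∩
      {ω | (openGraph ((↑η : Set (Sym2 (Site d))) ∪ (ω \ ↑(edgesIn (zdGraph d) Λ)))).Reachable x y} = ∅ :=
    Set.eq_empty_of_forall_notMem fun ω hω => hdec ω hω.1.2 hω.2
  have hout : (cylEvent ((edgesIn (zdGraph d) Λ).erase s(x, y)) η ∩ H) \
      {ω | (openGraph ((↑η : Set (Sym2 (Site d))) ∪ (ω \ ↑(edgesIn (zdGraph d) Λ)))).Reachable x y} =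
      cylEvent ((edgesIn (zdGraph d) Λ).erase s(x, y)) η ∩ H :=
    Disjoint.sdiff_eq_left (Set.disjoint_left.2 fun ω hω hK => hdec ω hω.2 hK)
  rw [hin, hout, measureReal_empty, mul_zero, zero_add, real_cylEvent_erase_inter_eq_add P he heη hHm] at h
  linear_combination h

end Step

/-! ### Two functions on the hypercube with the same one-edge ratios -/

section Hypercube

variable {α : Type*} [DecidableEq α]

/-- **Hypercube lemma**: two real functions on the patterns `η ⊆ U` with the same one-edge ratios
(`m(η ∪ e) = r · m(η)` and `c(η ∪ e) = r · c(η)` with a common `r = r(η, e)`) are proportional: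
`m(η) · c(∅) = m(∅) · c(η)`. (The combinatorial core of Grimmett's Thm. (3.1)(b): a measure on `{0,1}^E` is
determined by its one-edge conditional probabilities.) [cite: Grimmett2006, Thm. (3.1)(b)] -/
theorem mul_eq_mul_of_forall_insert (U : Finset α) (m c : Finset α → ℝ)
    (h : ∀ e ∈ U, ∀ η ⊆ U, e ∉ η → ∃ r : ℝ, m (insert e η) = r * m η ∧ c (insert e η) = r * c η)
    {η : Finset α} (hη : η ⊆ U) : m η * c ∅ = m ∅ * c η := by
  induction η using Finset.induction_on with
  | empty => ring
  | insert a s has ih =>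
    have haU : a ∈ U := hη (Finset.mem_insert_self a s)
    have hsU : s ⊆ U := (Finset.subset_insert a s).trans hη
    obtain ⟨r, hm, hc⟩ := h a haU s hsU has
    rw [hm, hc, mul_assoc, ih hsU]
    ring

omit [DecidableEq α] in
/-- If a function on the patterns `η ⊆ U` vanishes off the full pattern, its sum over the hypercube is its
value at `U`. [folklore] -/
theorem sum_powerset_eq_of_forall_ne_eq_zero (U : Finset α) (m : Finset α → ℝ)
    (h : ∀ η ⊆ U, η ≠ U → m η = 0) : ∑ η ∈ U.powerset, m η = m U :=
  Finset.sum_eq_single_of_mem U (Finset.mem_powerset_self U) fun η hη hne =>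
    h η (Finset.mem_powerset.1 hη) hne

/-- A proper sub-pattern misses an edge of `U`. [folklore] -/
theorem exists_mem_notMem_of_ssubset {U η : Finset α} (hη : η ⊆ U) (hne : η ≠ U) : ∃ e ∈ U, e ∉ η := by
  by_contra hcon
  push Not at hcon
  exact hne (Finset.Subset.antisymm hη hcon)

end Hypercube

/-! ### The DLR identity on cylinders inside one fibre, and on every outside event -/

section Fibre

variable {p q : ℝ} {P : Measure (BondConfig (Site d))}

/-- The cylinder probabilities inside a measurable event sum to its probability. [cite: Grimmett2006, §4.1] -/
theorem sum_real_cylEvent_inter (P : Measure (BondConfig (Site d))) [IsFiniteMeasure P]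
    (U : Finset (Sym2 (Site d))) {A : Set (BondConfig (Site d))} (hA : MeasurableSet A) :
    ∑ η ∈ U.powerset, P.real (cylEvent U η ∩ A) = P.real A := by
  rw [measureReal_def, measure_eq_sum_measure_cylEvent_inter P U hA,
    ENNReal.toReal_sum fun η _ => measure_ne_top _ _]
  rfl

/-- For `p < 1` the kernel gives the empty (all-closed) pattern positive probability. [cite: Grimmett2006, §4.2 (4.12)] -/
theorem rcCondProb_empty_pos (hp : p ∈ Set.Icc (0 : ℝ) 1) (hp1 : p < 1) (hq : 0 < q) (Λ : Finset (Site d))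
    (ξ : BondConfig (Site d)) : 0 < rcCondProb p q Λ ξ ∅ := by
  rw [rcCondProb_eq]
  refine div_pos ?_ (rcCondPartition_pos hp hq Λ ξ)
  rw [rcCondWeight_eq, Finset.card_empty, pow_zero, one_mul]
  have h1 : 0 < 1 - p := sub_pos.2 hp1
  positivity

/-- **The DLR identity on cylinders inside one fibre** (Grimmett's "`μ^ξ = φ^ξ_{Λ,p,q}`"): under (4.38), if the
outside event `H ∈ 𝒯_Λ` decides every connection question "`u ↔ v` in `η' ∪ (ω ∖ E_Λ)`?" (`η' ⊆ E_Λ`,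
`u, v ∈ Λ`) the same way as a fixed configuration `ξ₀`, then for every inside pattern `η ⊆ E_Λ`,
`P({ω ∩ E_Λ = η} ∩ H) = φ^{ξ₀}_{Λ,p,q}(η) · P(H)`. [cite: Grimmett2006, Prop. (4.37)(b), proof p. 87; Thm. (3.1)(b)] -/
theorem real_cylEvent_inter_eq_rcCondProb_mul_of_fibre [IsFiniteMeasure P] (hp : p ∈ Set.Icc (0 : ℝ) 1)
    (hq : 0 < q)
    (hE : ∀ ⦃x y : Site d⦄, (zdGraph d).Adj x y → ∀ ⦃H₀ : Set (BondConfig (Site d))⦄, MeasurableSet H₀ →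
      P.real ({ω | s(x, y) ∈ ω} ∩ (fun η => η \ {s(x, y)}) ⁻¹' H₀) =
        p * P.real ((fun η => η \ {s(x, y)}) ⁻¹' (H₀ ∩ openConn x y)) +
          p / (p + q * (1 - p)) * P.real ((fun η => η \ {s(x, y)}) ⁻¹' (H₀ ∩ (openConn x y)ᶜ)))
    (Λ : Finset (Site d)) {H : Set (BondConfig (Site d))} (hH : MeasurableSet[outsideEvents d Λ] H)
    {ξ₀ : BondConfig (Site d)}
    (hfib : ∀ ω ∈ H, ∀ η' ⊆ edgesIn (zdGraph d) Λ, ∀ u ∈ Λ, ∀ v ∈ Λ,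
      ((openGraph ((↑η' : Set (Sym2 (Site d))) ∪ (ω \ ↑(edgesIn (zdGraph d) Λ)))).Reachable u v ↔
        (openGraph ((↑η' : Set (Sym2 (Site d))) ∪ (ξ₀ \ ↑(edgesIn (zdGraph d) Λ)))).Reachable u v))
    {η : Finset (Sym2 (Site d))} (hη : η ⊆ edgesIn (zdGraph d) Λ) :
    P.real (cylEvent (edgesIn (zdGraph d) Λ) η ∩ H) = rcCondProb p q Λ ξ₀ η * P.real H := by
  classical
  set U := edgesIn (zdGraph d) Λ with hU
  have hHm : MeasurableSet H := outsideEvents_le Λ _ hH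
  set m : Finset (Sym2 (Site d)) → ℝ := fun η => P.real (cylEvent U η ∩ H) with hm
  set c : Finset (Sym2 (Site d)) → ℝ := fun η => rcCondProb p q Λ ξ₀ η with hc
  have hsum_m : ∑ η ∈ U.powerset, m η = P.real H := sum_real_cylEvent_inter P U hHm
  have hsum_c : ∑ η ∈ U.powerset, c η = 1 := sum_rcCondProb_eq_one hp hq Λ ξ₀
  set p' := p / (p + q * (1 - p)) with hp'
  -- the common one-edge relations of `m` and `c`
  have hstep : ∀ e ∈ U, ∀ η ⊆ U, e ∉ η → ∃ π : ℝ, (π = p ∨ π = p') ∧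
      m (insert e η) * (1 - π) = π * m η ∧ c (insert e η) * (1 - π) = π * c η := by
    intro e he
    induction e using Sym2.ind with
    | h x y =>
      intro η hηU heη
      have hx : x ∈ Λ := (mem_edgesIn_iff.1 he).2 x (Sym2.mem_mk_left x y)
      have hy : y ∈ Λ := (mem_edgesIn_iff.1 he).2 y (Sym2.mem_mk_right x y)
      have hker := rcCondProb_insert_mul_one_sub hp hq Λ ξ₀ he heη
      by_cases hR : (openGraph ((↑η : Set (Sym2 (Site d))) ∪ (ξ₀ \ ↑U))).Reachable x y
      · rw [if_pos hR] at hker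
        refine ⟨p, Or.inl rfl, ?_, hker⟩
        exact real_cylEvent_insert_inter_mul_of_reachable hE Λ he hηU heη hH fun ω hω =>
          (hfib ω hω η hηU x hx y hy).2 hR
      · rw [if_neg hR] at hker
        refine ⟨p', Or.inr rfl, ?_, hker⟩
        exact real_cylEvent_insert_inter_mul_of_not_reachable hE Λ he hηU heη hH fun ω hω hω' =>
          hR ((hfib ω hω η hηU x hx y hy).1 hω')
  change m η = c η * P.real H
  rcases hp.2.lt_or_eq with hp1 | hp1
  · -- `p < 1`: all ratios are finite, the two functions are proportional
    have hp'1 : p' < 1 := by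
      rw [hp', div_lt_one (add_mul_one_sub_pos hp hq)]
      nlinarith [mul_pos hq (sub_pos.2 hp1)]
    have hratio : ∀ e ∈ U, ∀ η ⊆ U, e ∉ η → ∃ r : ℝ, m (insert e η) = r * m η ∧ c (insert e η) = r * c η := by
      intro e he η hηU heη
      obtain ⟨π, hπ, hmπ, hcπ⟩ := hstep e he η hηU heη
      have hπ1 : 1 - π ≠ 0 := by
        rcases hπ with rfl | rfl
        · exact sub_ne_zero.2 (ne_of_gt hp1)
        · exact sub_ne_zero.2 (ne_of_gt hp'1)
      refine ⟨π / (1 - π), ?_, ?_⟩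
      · field_simp
        linear_combination hmπ
      · field_simp
        linear_combination hcπ
    have hprop := mul_eq_mul_of_forall_insert U m c hratio hη
    have hprop0 : P.real H * c ∅ = m ∅ := by
      have := Finset.sum_congr rfl fun η' (hη' : η' ∈ U.powerset) =>
        mul_eq_mul_of_forall_insert U m c hratio (Finset.mem_powerset.1 hη')
      rw [← Finset.sum_mul, ← Finset.mul_sum, hsum_m, hsum_c, mul_one] at this
      exact this
    have hc0 : c ∅ ≠ 0 := (rcCondProb_empty_pos hp hp1 hq Λ ξ₀).ne'
    apply mul_right_cancel₀ hc0
    rw [hprop, ← hprop0]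
    ring
  · -- `p = 1`: both functions vanish off the full pattern
    have hp'one : p' = 1 := by rw [hp', hp1]; norm_num
    have hzero : ∀ η' ⊆ U, η' ≠ U → m η' = 0 ∧ c η' = 0 := by
      intro η' hη'U hne
      obtain ⟨e, heU, heη'⟩ := exists_mem_notMem_of_ssubset hη'U hne
      obtain ⟨π, hπ, hmπ, hcπ⟩ := hstep e heU η' hη'U heη'
      have hπ1 : π = 1 := by
        rcases hπ with rfl | rfl
        · exact hp1
        · exact hp'one
      rw [hπ1, sub_self, mul_zero, one_mul] at hmπ hcπ
      exact ⟨hmπ.symm, hcπ.symm⟩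
    by_cases hηU : η = U
    · have hmU : m U = P.real H := by
        rw [← hsum_m]
        exact (sum_powerset_eq_of_forall_ne_eq_zero U m fun η' hη' hne => (hzero η' hη' hne).1).symm
      have hcU : c U = 1 := by
        rw [← hsum_c]
        exact (sum_powerset_eq_of_forall_ne_eq_zero U c fun η' hη' hne => (hzero η' hη' hne).2).symm
      rw [hηU, hmU, hcU, one_mul]
    · rw [(hzero η hη hηU).1, (hzero η hη hηU).2, zero_mul]

end Fibre

end Summit.CriticalPhenomena.PercolationContinuityZ3.Theorems.FK

end
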